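import Literature.MathematicalPhysics.KineticTheory.HardSphereDisplacementPathLength
import Literature.MathematicalPhysics.KineticTheory.VelocityBlindPlacement
import HarnessLib

/-!
# Total in-window displacement of a hard-sphere gas against its kinetic energy; the kinetic pair-weight dictionary

Topic `Literature/MathematicalPhysics/KineticTheory` (proof item; companion of
`HardSphereDisplacementPathLength` and `VelocityBlindPlacement` §3). Wanted by the kinetic-cell dockings into the route
target `ContactChaos` of `InformationPercolationEngine` (crux `PercolationClosesChaos`, stmt-AtomisticToContinuum-15178, line
`equilibrium-forecast-chain-rule`, stub S7 `stub_docking`; wave-1 audit `stub_docking.audit.md` on the item): there the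
target's weights of a collision `(s, i, j)` of a step of length `Δ_N` are frozen at the step start, and the spatial offset is
the IN-STEP DISPLACEMENT `dist(x_i(s), x_i(kΔ_N))` — not `O(Δ_N)` deterministically (a sphere moves `|v_i| Δ_N`,
`|v_i| ≤ √(2E) ≍ √N`). What conservation of energy DOES give, with a `√N` Cauchy–Schwarz gain, is proved here:

* §1 `HardSphereFlow.sum_euclidDist_flow_le`: along a good orbit of a hard-sphere flow on `T^d`, reading every sphere at
  its own time `s_i ∈ [t₁, t₂]`, `Σ_i dist(x_i(s_i), x_i(t₁)) ≤ (t₂ − t₁) √(N · 2E(z))` (minimal-image distance); hence at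
  most `(t₂ − t₁)√(N·2E(z))/δ` spheres are displaced by more than `δ` (`HardSphereFlow.card_displaced_mul_le`). With
  `E(z) = O(N)` (local Gibbs data) this is `O(N Δ_N)` in total over a window of length `Δ_N`, i.e. `O(Δ_N) → 0` per sphere.
  Ingredients: the pathwise path-length bound `HardSphereFlow.euclidDist_flow_le_integral_norm_vel`, Cauchy–Schwarz over
  the spheres at each time (`sum_norm_vel_le_sqrt`), `HardSphereFlow.configEnergy_flow`.
* §2 `VelocityBlindPlacement.pairWeight_mul_cellCount`: the dictionary between the target's weight `ε_N/(N+1)` per ordered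
  contact pair and cell-pair statistics normalised by `n̄ c`, `n̄ = (N+1)(cℓ_N)³` spheres per kinetic cell of side `cℓ_N`:
  `(ε_N/(N+1))·(n̄ c) = π σ³ · Δ_N · (cℓ_N)³`, `Δ_N = cℓ_N` (from `hsDiameter_div_meanFreePath`, i.e.
  `ε_N = πσ³ ℓ_N`, `hsDiameter_eq_pi_mul_meanFreePath`).

Not here (already in the tree): the target's mollified pool pair field and its Lipschitz moduli (`MollifiedPoolPairField`:
`poolPairField`, `abs_poolPairField_le`, `abs_poolPairField_sub_le`). Theorems only, no definitions.

## References

* I. Gallagher, L. Saint-Raymond, B. Texier, *From Newton to Boltzmann* (2013), §4.1 (Prop. 4.1.1: trajectories are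
  piecewise free flight with continuous positions). [GST2013]
* C. Cercignani, R. Illner, M. Pulvirenti, *The Mathematical Theory of Dilute Gases* (1994), §4.2 (conservation of the
  kinetic energy). [CIP1994]
-/
noncomputable section

open MeasureTheory Set Filter
open scoped BigOperators Interval
open Literature.Analysis.FluidPDE

namespace Literature.MathematicalPhysics.KineticTheory

variable {d : Type*} [Fintype d] {X : Type*} {ε : ℝ} {N : ℕ}

/-! ## §1 Total displacement of all spheres against the kinetic energy -/

/-- Cauchy–Schwarz: the total speed of `N` spheres is at most `√(N · 2E)`, `E = ½ Σ ‖v_i‖²`. [folklore] -/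
theorem sum_norm_vel_le_sqrt (z : Config N d X) :
    ∑ i, ‖(z i).2‖ ≤ Real.sqrt (N * (2 * configEnergy z)) := by
  have hE : 2 * configEnergy z = ∑ i, ‖(z i).2‖ ^ 2 := by
    simp only [configEnergy]
    ring
  have hcs := Finset.sum_mul_sq_le_sq_mul_sq Finset.univ (fun _ : Fin N => (1 : ℝ)) (fun i => ‖(z i).2‖)
  simp only [one_pow, Finset.sum_const, Finset.card_univ, Fintype.card_fin, nsmul_eq_mul, mul_one,
    one_mul] at hcs
  rw [hE]
  exact (le_abs_self _).trans (Real.abs_le_sqrt hcs)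

/-- Along a good orbit the total speed at every time is at most `√(N · 2E(z))` (energy conservation,
`HardSphereFlow.configEnergy_flow`). [folklore] -/
theorem _root_.Literature.Analysis.FluidPDE.HardSphereFlow.sum_norm_vel_flow_le [MeasureSpace X]
    [TopologicalSpace X] {G : Geometry d X}
    (Φ : HardSphereFlow G ε N) {z : Config N d X} (hz : z ∈ Φ.good) (u : ℝ) :
    ∑ i, ‖(Φ.flow u z i).2‖ ≤ Real.sqrt (N * (2 * configEnergy z)) := by
  rw [← Φ.configEnergy_flow hz u]
  exact sum_norm_vel_le_sqrt _

/-- The total path length of all spheres over `[t₁, t₂]` is at most `(t₂ − t₁) √(N · 2E(z))`. [folklore] -/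
theorem _root_.Literature.Analysis.FluidPDE.HardSphereFlow.sum_integral_norm_vel_flow_le
    (Φ : HardSphereFlow (Torus.geometry d) ε N)
    {z : Config N d (UnitAddTorus d)} (hz : z ∈ Φ.good) {t₁ t₂ : ℝ} (h12 : t₁ ≤ t₂) :
    ∑ i, ∫ u in t₁..t₂, ‖(Φ.flow u z i).2‖ ≤ (t₂ - t₁) * Real.sqrt (N * (2 * configEnergy z)) := by
  have hint : ∀ i ∈ (Finset.univ : Finset (Fin N)),
      IntervalIntegrable (fun u => ‖(Φ.flow u z i).2‖) volume t₁ t₂ :=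
    fun i _ => Φ.intervalIntegrable_norm_vel_flow hz i t₁ t₂
  rw [← intervalIntegral.integral_finsetSum hint]
  have hsum : IntervalIntegrable (fun u => ∑ i, ‖(Φ.flow u z i).2‖) volume t₁ t₂ := by
    have hfn : (fun u => ∑ i, ‖(Φ.flow u z i).2‖) = ∑ i, fun u => ‖(Φ.flow u z i).2‖ := by
      funext u
      simp only [Finset.sum_apply]
    rw [hfn]
    exact IntervalIntegrable.sum Finset.univ hint
  have h := intervalIntegral.integral_mono_on h12 hsum intervalIntegrable_const
    fun u _ => Φ.sum_norm_vel_flow_le hz u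
  rwa [intervalIntegral.integral_const, smul_eq_mul] at h

/-- **Total in-window displacement against the energy.** Along a good orbit of a hard-sphere flow on the
flat torus, reading every sphere `i` at its own time `s i ∈ [t₁, t₂]`,
`Σ_i dist(x_i(s_i), x_i(t₁)) ≤ (t₂ − t₁) √(N · 2E(z))` (minimal-image distance): path-length bound sphere
by sphere (`HardSphereFlow.euclidDist_flow_le_integral_norm_vel`), then Cauchy–Schwarz over the spheres at
each time and conservation of energy (GST 2013 §4.1; CIP 1994 §4.2). [cite: GST2013, §4.1 Prop. 4.1.1] -/
theorem _root_.Literature.Analysis.FluidPDE.HardSphereFlow.sum_euclidDist_flow_le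
    (Φ : HardSphereFlow (Torus.geometry d) ε N)
    {z : Config N d (UnitAddTorus d)} (hz : z ∈ Φ.good) {t₁ t₂ : ℝ} (h12 : t₁ ≤ t₂)
    (s : Fin N → ℝ) (hs : ∀ i, s i ∈ Icc t₁ t₂) :
    ∑ i, Torus.euclidDist (Φ.flow (s i) z i).1 (Φ.flow t₁ z i).1 ≤
      (t₂ - t₁) * Real.sqrt (N * (2 * configEnergy z)) := by
  refine le_trans (Finset.sum_le_sum fun i _ => ?_) (Φ.sum_integral_norm_vel_flow_le hz h12)
  exact (Φ.euclidDist_flow_le_integral_norm_vel hz i (hs i).1).trans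
    (Φ.integral_norm_vel_flow_mono hz i le_rfl (hs i).1 (hs i).2)

/-- **Few spheres are displaced far**: the number of spheres displaced by more than `δ > 0` (each read at
its own time in `[t₁, t₂]`) is at most `(t₂ − t₁) √(N · 2E(z)) / δ`. [folklore] -/
theorem _root_.Literature.Analysis.FluidPDE.HardSphereFlow.card_displaced_mul_le
    (Φ : HardSphereFlow (Torus.geometry d) ε N)
    {z : Config N d (UnitAddTorus d)} (hz : z ∈ Φ.good) {t₁ t₂ : ℝ} (h12 : t₁ ≤ t₂)
    (s : Fin N → ℝ) (hs : ∀ i, s i ∈ Icc t₁ t₂) (δ : ℝ) :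
    δ * ((Finset.univ.filter fun i =>
        δ < Torus.euclidDist (Φ.flow (s i) z i).1 (Φ.flow t₁ z i).1).card : ℝ) ≤
      (t₂ - t₁) * Real.sqrt (N * (2 * configEnergy z)) := by
  classical
  set F : Finset (Fin N) := Finset.univ.filter fun i =>
    δ < Torus.euclidDist (Φ.flow (s i) z i).1 (Φ.flow t₁ z i).1 with hF
  calc δ * (F.card : ℝ) = ∑ i ∈ F, δ := by
        rw [Finset.sum_const, nsmul_eq_mul, mul_comm]
    _ ≤ ∑ i ∈ F, Torus.euclidDist (Φ.flow (s i) z i).1 (Φ.flow t₁ z i).1 :=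
        Finset.sum_le_sum fun i hi => (Finset.mem_filter.1 hi).2.le
    _ ≤ ∑ i, Torus.euclidDist (Φ.flow (s i) z i).1 (Φ.flow t₁ z i).1 :=
        Finset.sum_le_sum_of_subset_of_nonneg (Finset.filter_subset _ _) fun i _ _ => by
          rw [Torus.euclidDist_eq]
          exact norm_nonneg _
    _ ≤ _ := Φ.sum_euclidDist_flow_le hz h12 s hs

/-! ## §2 The normalisation dictionary `ε_N/(N+1)` per ordered pair ↔ `πσ³ Δ_N (cℓ_N)³` per unit weight -/

/-- Kinetic units: `ε_N = π σ³ ℓ_N` (the diameter is a fixed multiple of the mean free path at fixed reduced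
density; `hsDiameter_div_meanFreePath`, including the degenerate `ℓ_N = 0`). [folklore] -/
theorem VelocityBlindPlacement.hsDiameter_eq_pi_mul_meanFreePath (σ : ℝ) (N : ℕ) :
    hsDiameter σ N = Real.pi * σ ^ 3 * VelocityBlindPlacement.meanFreePath σ N := by
  have h := VelocityBlindPlacement.hsDiameter_div_meanFreePath σ N
  by_cases hl : VelocityBlindPlacement.meanFreePath σ N = 0
  · have hε : hsDiameter σ N = 0 := by
      have hl' := hl
      unfold VelocityBlindPlacement.meanFreePath at hl'
      rw [inv_eq_zero] at hl'
      have hpi : Real.pi * ((N : ℝ) + 1) ≠ 0 := by positivity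
      have hsq : hsDiameter σ N ^ 2 = 0 := by
        rcases mul_eq_zero.1 hl' with h1 | h1
        · exact absurd h1 hpi
        · exact h1
      exact pow_eq_zero_iff (two_ne_zero) |>.1 hsq
    rw [hε, hl, mul_zero]
  · rwa [div_eq_iff hl] at h

/-- **The pair-weight dictionary.** With `n̄ := (N+1)(cℓ_N)³` spheres per kinetic cell and `Δ_N := c ℓ_N`:
`(ε_N/(N+1)) · (n̄ c) = π σ³ · Δ_N · (c ℓ_N)³` — the target's weight per ordered contact pair times the number of
pairs behind one unit of a cell-pair statistic normalised by `n̄ c` equals `π σ³ Δ_N` times the cell volume; summed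
over the `K_N = ⌊τ/Δ_N⌋` complete steps this is `π σ³ (K_N Δ_N) ≤ π σ³ τ` times the line's `unitAvg`. [folklore] -/
theorem VelocityBlindPlacement.pairWeight_mul_cellCount (σ c : ℝ) (N : ℕ) :
    hsDiameter σ N / ((N : ℝ) + 1) *
        ((((N : ℝ) + 1) * (c * VelocityBlindPlacement.meanFreePath σ N) ^ 3) * c) =
      Real.pi * σ ^ 3 * (c * VelocityBlindPlacement.meanFreePath σ N) *
        (c * VelocityBlindPlacement.meanFreePath σ N) ^ 3 := by
  have hN : ((N : ℝ) + 1) ≠ 0 := by positivity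
  rw [VelocityBlindPlacement.hsDiameter_eq_pi_mul_meanFreePath, div_mul_eq_mul_div, div_eq_iff hN]
  ring

end Literature.MathematicalPhysics.KineticTheory

end
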